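import Literature.AlgebraicGeometry.Frobenioids.FrobenioidMonoidIsoTransport
import HarnessLib

/-!
# Frobenioids I, Definition 1.2 (iv)/(v): the object TYPES along `F_θ` for an isomorphism `θ : Φ ≅ Φ'` of the
# divisor monoid (T3 addendum)

Mochizuki, *The geometry of Frobenioids I: the general theory*, Kyushu J. Math. **62** (2008) 293–400,
Definition 1.2 (iv) ("Frobenius-ample", "Frobenius-trivial", "quasi-Frobenius-trivial", "metrically trivial",
"base-trivial", "`Aut`-ample", "`End`-ample", "perfect", "group-like", "Frobenius-normalized", "unit-trivial",
"isotropic", …) and (v) ("of …-type"), kurims text pp. 22–23 [cite: MochizukiFrdI2008, Def. 1.2(iv)]; Prop. 2.5,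
p. 48 (the standing hypotheses "of Frobenius-normalized, metrically trivial and `Aut`-ample type").

PROOF-ONLY companion (no definitions) of `FrobenioidMonoidIsoTransport.lean` (GAP-LEDGER row G-L6t9-1 part (T3),
abc-iut cell, seat abc-iut-w4-d018), mirroring abc-iut-L6-t9's `FrobenioidNatIsoTypes.lean` (the (T2) addendum for
a natural isomorphism of the structure functor). For `F' := F ⋙ ElemFrobenioid.map κ` every `Base`/`deg_Fr`-type of
Def. 1.2 (iv) is LITERALLY the same (`Iff.rfl`: Frobenius-ample, quasi-Frobenius-trivial, base-trivial, `Aut`-ample, `Aut^sub`-ample,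
`End`-ample, Frobenius-normalized, unit-trivial, step); for an isomorphism `θ : Φ ≅ Φ'` the `Div`-types transport
through the dictionary (metrically trivial, sub-quasi-Frobenius-trivial, perfect, group-like, `Div`-identity /
`Div`-equivalent / `Div`-Frobenius-trivial / universally so, primary pre-step, prime-Frobenius, Frobenius-isotropic),
and the "of …-type" conditions of (v), in particular Prop. 2.5's standing hypotheses (`isOfType_prop25_comp_map_iff`).
[folklore] bookkeeping over the tree's typed Def. 1.2; nothing of [FrdI] is asserted.
-/

noncomputable section

namespace Literature.AlgebraicGeometry.Frobenioids

open CategoryTheory Opposite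

universe w v v' u u'

variable {D : Type u} [Category.{v} D] {Φ Φ' : Dᵒᵖ ⥤ CommMonCat.{w}}

namespace PreFrobenioid

variable {C : Type u'} [Category.{v'} C] {F : C ⥤ ElemFrobenioid Φ}

/-! ### `Base`/`deg_Fr`-types: literally unchanged along any `κ : Φ → Φ'` -/

section AnyHom

variable (κ : Φ ⟶ Φ')

/-- Frobenius-ample objects are the same. [cite: MochizukiFrdI2008, Def. 1.2(iv)] -/
theorem isFrobeniusAmple_comp_map_iff (A : C) :
    IsFrobeniusAmple (F ⋙ ElemFrobenioid.map κ) A ↔ IsFrobeniusAmple F A := Iff.rfl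

/-- Quasi-Frobenius-trivial objects are the same. [cite: MochizukiFrdI2008, Def. 1.2(iv)] -/
theorem isQuasiFrobeniusTrivial_comp_map_iff (A : C) :
    IsQuasiFrobeniusTrivial (F ⋙ ElemFrobenioid.map κ) A ↔ IsQuasiFrobeniusTrivial F A := Iff.rfl

/-- Base-isomorphic pairs are the same. [cite: MochizukiFrdI2008, Def. 1.2(i)] -/
theorem baseIsomorphic_comp_map_iff (A B : C) :
    BaseIsomorphic (F ⋙ ElemFrobenioid.map κ) A B ↔ BaseIsomorphic F A B := Iff.rfl

/-- Base-trivial objects are the same. [cite: MochizukiFrdI2008, Def. 1.2(iv)] -/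
theorem isBaseTrivial_comp_map_iff (A : C) :
    IsBaseTrivial (F ⋙ ElemFrobenioid.map κ) A ↔ IsBaseTrivial F A := Iff.rfl

/-- `Aut`-ample objects are the same (same projection functor `C → D`). [cite: MochizukiFrdI2008, Def. 1.2(iv)] -/
theorem isAutAmple_comp_map_iff (A : C) :
    IsAutAmple (F ⋙ ElemFrobenioid.map κ) A ↔ IsAutAmple F A := Iff.rfl

/-- `Aut^sub`-ample objects are the same. [cite: MochizukiFrdI2008, Def. 1.2(iv)] -/
theorem isAutSubAmple_comp_map_iff (A : C) :
    IsAutSubAmple (F ⋙ ElemFrobenioid.map κ) A ↔ IsAutSubAmple F A := Iff.rfl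

/-- `End`-ample objects are the same. [cite: MochizukiFrdI2008, Def. 1.2(iv)] -/
theorem isEndAmple_comp_map_iff (A : C) :
    IsEndAmple (F ⋙ ElemFrobenioid.map κ) A ↔ IsEndAmple F A := Iff.rfl

/-- Frobenius-normalized objects are the same (`O^▷(A)` is the same submonoid). [cite: MochizukiFrdI2008, Def. 1.2(iv)] -/
theorem isFrobeniusNormalized_comp_map_iff (A : C) :
    IsFrobeniusNormalized (F ⋙ ElemFrobenioid.map κ) A ↔ IsFrobeniusNormalized F A := Iff.rfl

/-- Unit-trivial objects are the same (`O^×(A)` is the same subgroup). [cite: MochizukiFrdI2008, Def. 1.2(iv)] -/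
theorem isUnitTrivial_comp_map_iff (A : C) :
    IsUnitTrivial (F ⋙ ElemFrobenioid.map κ) A ↔ IsUnitTrivial F A := Iff.rfl

/-- Steps are the same. [cite: MochizukiFrdI2008, Def. 1.2(iii)] -/
theorem isStep_comp_map_iff {A B : C} (φ : A ⟶ B) :
    IsStep (F ⋙ ElemFrobenioid.map κ) φ ↔ IsStep F φ := Iff.rfl

end AnyHom

/-! ### `Div`-types along an isomorphism `θ : Φ ≅ Φ'` -/

section IsoHom

variable (θ : Φ ≅ Φ')

/-- `Div`-equivalence is the same: `f^*_{Φ'} = θ ∘ f^*_Φ ∘ θ⁻¹`. [cite: MochizukiFrdI2008, Def. 1.2(ii)] -/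
theorem divEquivalent_comp_map_iff {A B : C} (φ ψ : A ⟶ B) :
    DivEquivalent (F ⋙ ElemFrobenioid.map θ.hom) φ ψ ↔ DivEquivalent F φ ψ := by
  change pull Φ' (Base F φ) = pull Φ' (Base F ψ) ↔ pull Φ (Base F φ) = pull Φ (Base F ψ)
  constructor
  · intro h
    ext x
    apply iso_hom_app_injective θ
    rw [hom_app_pull θ.hom (Base F φ) x, hom_app_pull θ.hom (Base F ψ) x, h]
  · intro h
    ext y
    rw [pull_eq_conj_of_iso θ (Base F φ), pull_eq_conj_of_iso θ (Base F ψ), h]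

/-- `Div`-identity endomorphisms are the same. [cite: MochizukiFrdI2008, Def. 1.2(ii)] -/
theorem isDivIdentity_comp_map_iff {A : C} (φ : A ⟶ A) :
    IsDivIdentity (F ⋙ ElemFrobenioid.map θ.hom) φ ↔ IsDivIdentity F φ := by
  change pull Φ' (Base F φ) = MonoidHom.id _ ↔ pull Φ (Base F φ) = MonoidHom.id _
  constructor
  · intro h
    ext x
    apply iso_hom_app_injective θ
    rw [hom_app_pull θ.hom (Base F φ) x, h, MonoidHom.id_apply, MonoidHom.id_apply]
  · intro h
    ext y
    rw [pull_eq_conj_of_iso θ (Base F φ), h, MonoidHom.id_apply, ElemFrobenioid.iso_hom_app_inv_app_apply,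
      MonoidHom.id_apply]

/-- `Div`-Frobenius-trivial objects are the same. [cite: MochizukiFrdI2008, Def. 1.2(iv)] -/
theorem isDivFrobeniusTrivial_comp_map_iff (A : C) :
    IsDivFrobeniusTrivial (F ⋙ ElemFrobenioid.map θ.hom) A ↔ IsDivFrobeniusTrivial F A :=
  exists_congr fun _ => forall_congr' fun _ =>
    and_congr Iff.rfl (and_congr (isDivIdentity_comp_map_iff θ _) (isFrobeniusType_comp_map_iff θ _))

/-- Universally `Div`-Frobenius-trivial objects are the same. [cite: MochizukiFrdI2008, Def. 1.2(iv)] -/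
theorem isUniversallyDivFrobeniusTrivial_comp_map_iff (A : C) :
    IsUniversallyDivFrobeniusTrivial (F ⋙ ElemFrobenioid.map θ.hom) A ↔ IsUniversallyDivFrobeniusTrivial F A :=
  forall_congr' fun _ => forall_congr' fun _ => imp_congr Iff.rfl (isDivFrobeniusTrivial_comp_map_iff θ _)

/-- Metrically trivial objects are the same. [cite: MochizukiFrdI2008, Def. 1.2(iv)] -/
theorem isMetricallyTrivial_comp_map_iff (A : C) :
    IsMetricallyTrivial (F ⋙ ElemFrobenioid.map θ.hom) A ↔ IsMetricallyTrivial F A :=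
  forall_congr' fun _ => forall_congr' fun ψ => imp_congr (isCoAngular_comp_map_iff θ ψ) Iff.rfl

/-- Sub-quasi-Frobenius-trivial objects are the same. [cite: MochizukiFrdI2008, Def. 1.2(iv)] -/
theorem isSubQuasiFrobeniusTrivial_comp_map_iff (A : C) :
    IsSubQuasiFrobeniusTrivial (F ⋙ ElemFrobenioid.map θ.hom) A ↔ IsSubQuasiFrobeniusTrivial F A :=
  exists_congr fun _ => exists_congr fun ψ => and_congr (isCoAngular_comp_map_iff θ ψ) Iff.rfl

/-- Perfect objects are the same. [cite: MochizukiFrdI2008, Def. 1.2(iv)] -/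
theorem isPerfectObj_comp_map_iff (A : C) :
    IsPerfectObj (F ⋙ ElemFrobenioid.map θ.hom) A ↔ IsPerfectObj F A := by
  refine forall_congr' fun n => and_congr ?_ ?_
  · exact forall_congr' fun _ => imp_congr Iff.rfl <| exists_congr fun _ => exists_congr fun φ =>
      and_congr (isFrobeniusType_comp_map_iff θ φ) Iff.rfl
  · refine forall_congr' fun _ => forall_congr' fun _ => forall_congr' fun _ => forall_congr' fun _ =>
      forall_congr' fun φ₁ => forall_congr' fun φ₂ => imp_congr Iff.rfl <| imp_congr Iff.rfl <|
        imp_congr (isFrobeniusType_comp_map_iff θ φ₁) <| imp_congr Iff.rfl <|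
          imp_congr (isFrobeniusType_comp_map_iff θ φ₂) <| imp_congr Iff.rfl Iff.rfl

/-- Group-like objects are the same (`Φ'(A) = 0 ↔ Φ(A) = 0`, `θ_A` being a bijection). [cite: MochizukiFrdI2008, Def. 1.2(iv)] -/
theorem isGroupLikeObj_comp_map_iff (A : C) :
    IsGroupLikeObj (F ⋙ ElemFrobenioid.map θ.hom) A ↔ IsGroupLikeObj F A := by
  change (∀ y : Φ'.obj (op (baseObj F A)), y = 1) ↔ (∀ x : Φ.obj (op (baseObj F A)), x = 1)
  constructor
  · intro h x
    apply iso_hom_app_injective θ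
    rw [map_one]
    exact h _
  · intro h y
    rw [← ElemFrobenioid.iso_hom_app_inv_app_apply θ (op (baseObj F A)) y, h ((θ.inv.app _).hom y), map_one]

/-- Primary pre-steps are the same (primariness is invariant under the isomorphism `θ_A` of monoids, FrdI §0).
[cite: MochizukiFrdI2008, Def. 1.2(iii)] -/
theorem isPrimaryPreStep_comp_map_iff {A B : C} (φ : A ⟶ B) :
    IsPrimaryPreStep (F ⋙ ElemFrobenioid.map θ.hom) φ ↔ IsPrimaryPreStep F φ :=
  and_congr Iff.rfl (isPrimary_map_iff (θ.app (op (baseObj F A))).commMonCatIsoToMulEquiv)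

/-- Prime-Frobenius morphisms are the same. [cite: MochizukiFrdI2008, Def. 1.2(iii)] -/
theorem isPrimeFrobenius_comp_map_iff {A B : C} (φ : A ⟶ B) :
    IsPrimeFrobenius (F ⋙ ElemFrobenioid.map θ.hom) φ ↔ IsPrimeFrobenius F φ :=
  and_congr (isFrobeniusType_comp_map_iff θ φ) Iff.rfl

/-- Frobenius-isotropic objects are the same. [cite: MochizukiFrdI2008, Def. 1.2(iv)] -/
theorem isFrobeniusIsotropic_comp_map_iff (A : C) :
    IsFrobeniusIsotropic (F ⋙ ElemFrobenioid.map θ.hom) A ↔ IsFrobeniusIsotropic F A :=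
  exists_congr fun B => exists_congr fun φ =>
    and_congr (isFrobeniusType_comp_map_iff θ φ) (isIsotropic_comp_map_iff θ B)

/-! ### Definition 1.2 (v): "of …-type" -/

/-- Of isotropic type iff. [cite: MochizukiFrdI2008, Def. 1.2(v)] -/
theorem isOfIsotropicType_comp_map_iff :
    IsOfIsotropicType (F ⋙ ElemFrobenioid.map θ.hom) ↔ IsOfIsotropicType F :=
  forall_congr' fun A => isIsotropic_comp_map_iff θ A

/-- Of perfect type iff. [cite: MochizukiFrdI2008, Def. 1.2(v)] -/
theorem isOfPerfectType_comp_map_iff :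
    IsOfPerfectType (F ⋙ ElemFrobenioid.map θ.hom) ↔ IsOfPerfectType F :=
  forall_congr' fun A => isPerfectObj_comp_map_iff θ A

/-- Of Frobenius-trivial type iff. [cite: MochizukiFrdI2008, Def. 1.2(v)] -/
theorem isOfFrobeniusTrivialType_comp_map_iff :
    IsOfFrobeniusTrivialType (F ⋙ ElemFrobenioid.map θ.hom) ↔ IsOfFrobeniusTrivialType F :=
  forall_congr' fun A => isFrobeniusTrivial_comp_map_iff θ A

/-- Of metrically trivial type iff. [cite: MochizukiFrdI2008, Def. 1.2(v)] -/
theorem isOfType_isMetricallyTrivial_comp_map_iff :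
    IsOfType (IsMetricallyTrivial (F ⋙ ElemFrobenioid.map θ.hom)) ↔ IsOfType (IsMetricallyTrivial F) :=
  forall_congr' fun A => isMetricallyTrivial_comp_map_iff θ A

/-- The standing hypotheses of [FrdI] Prop. 2.5 / Cor. 2.6 ("of Frobenius-normalized, metrically trivial and
`Aut`-ample type") hold for `F ⋙ F_θ` iff for `F`. [cite: MochizukiFrdI2008, Prop. 2.5 p.48] -/
theorem isOfType_prop25_comp_map_iff :
    (IsOfType (IsFrobeniusNormalized (F ⋙ ElemFrobenioid.map θ.hom)) ∧
        IsOfType (IsMetricallyTrivial (F ⋙ ElemFrobenioid.map θ.hom)) ∧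
          IsOfType (IsAutAmple (F ⋙ ElemFrobenioid.map θ.hom))) ↔
      (IsOfType (IsFrobeniusNormalized F) ∧ IsOfType (IsMetricallyTrivial F) ∧ IsOfType (IsAutAmple F)) :=
  and_congr Iff.rfl (and_congr (isOfType_isMetricallyTrivial_comp_map_iff θ) Iff.rfl)

end IsoHom

end PreFrobenioid

end Literature.AlgebraicGeometry.Frobenioids

end
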